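import Summits.BirchSwinnertonDyer.BirchSwinnertonDyer.Theorems.CountingDoorF2AtThreeSelmerAverageRankFourShare
import HarnessLib

/-!
# BirchSwinnertonDyer / CountingDoorF2AtThree — crux I1 `SelmerThreeAverageLargeF2`
# (stmt-BirchSwinnertonDyer-19440): the AVERAGE-RANK CAP `19/6`, an instrument of I1 that a certified census of
# independent points can drive

Route `route-BirchSwinnertonDyer-CountingDoorF2AtThree` (cell bsd-rank2, leaf T-r2). Third lever of the series
`…SelmerAverageRankMoment.lean` (p582870: I1 ⇒ `limsup avg 3^rank ≤ 36`), `…SelmerAverageRankFourShare.lean`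
(p596004: I1 ⇒ `limsup prop(rank ≥ 4) ≤ 7/16`). By convexity of `r ↦ 3^r` on `ℕ` the secant through
`(3, 27)` and `(4, 81)` lies below the graph: `54r − 135 ≤ 3^r` for every `r : ℕ`, hence on every nonempty height
ball `54·avg rank − 135 ≤ avg 3^rank ≤ avg #Sel₃`, and:

* `averageRank_le_of_selmerThreeAverageLE`: `Φ.AverageOnLE #Sel₃ c` (`c ≥ 0`) ⇒ for every `ε > 0`, eventually
  `avg_{Φ(<X)} rank E_a(ℚ) ≤ (c + 135)/54 + ε`;
* **`averageRank_le_of_selmerThreeAverageLargeF2`**: the route decl I1 (BY NAME) ⇒ `limsup_X avg_{Φ(<X)} rank ≤ 19/6`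
  (`= (36 + 135)/54 ≈ 3.1667`) on every large `Φ ⊆ F₂`, in the ε-form and in the `AverageOnLE` currency
  (the same secant argument run on Bhargava–Ho's `avg #Sel₂ ≤ 12` gives only `7/2`);
* `not_selmerThreeAverageLargeF2_of_frequently_averageRank` and its CERTIFIED form
  `not_selmerThreeAverageLargeF2_of_frequently_average_lowerBound`: ONE large `Φ`, one `ε > 0` and a member-wise LOWER
  bound `ℓ a ≤ rank E_a(ℚ)` (independent points: a certificate, no descent upper bound, no Ш) whose finite averages
  exceed `19/6 + ε` for infinitely many `X` refute I1.

NUMBERS (instrument readings of record; bsd-rank2-sel3-p2 GEN 3/4, `HOME/bsd-rank2-sel3-p2/data/rankmoment/`, kit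
j295264, j296636 + j297123, PARI `ellrank` with `r = R` on all but `≤ 2.5·10⁻⁴`, tuple-weighted WINDOW averages of F₂):
average rank `3.08` on `[10¹², 10¹³)`, `3.117` on `[10¹³, 10¹⁴)`, `3.147` on `[10¹⁴, 10¹⁵)` (increments `+.039`, `+.03`
per decade, no turnover through `10¹⁵`), against the I1 ceiling `19/6 = 3.1667` for the limsup of the CUMULATIVE averages
`avg_{Φ(<X)}` (which lag the windows). I1 is a limsup statement; this is calibration: a persistent, certified average
rank above `19/6` on a large `Φ` is what refutes I1, and the family's window is `0.02` below it at `10¹⁵`.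

HONEST FRAMING (B1). Bookkeeping (Kummer injection + convexity + averaging) typing an instrument of an OPEN crux;
nothing reads an analytic rank; no S0 motion; I1 is neither proved nor refuted; BSD is not proved by any of this.
PARTITION: none — r_an ≥ 2, summit axis S0; TWIN (D-0056): n/a.

References: J. Silverman, AEC X.4.2 (Kummer sequence) [SilvermanAEC2009]; M. Bhargava, W. Ho, arXiv:2207.03309
(2022), Thm. 1.1–1.3 (Selmer averages and average ranks in F₂) [BhargavaHo2022]; B. Poonen, E. Rains, J. AMS 25
(2012) (the model value `36`) [PoonenRains2012].
-/

set_option linter.dupNamespace false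

noncomputable section

open scoped Classical
open Filter Topology Finset
open WeierstrassCurve Literature.NumberTheory.EllipticCurves
  Literature.NumberTheory.EllipticCurves.BhargavaHo2022
  Summit.BirchSwinnertonDyer.Rank2
  Summit.BirchSwinnertonDyer.BirchSwinnertonDyer.Theses.CountingDoorF2AtThree

namespace Summit.BirchSwinnertonDyer.BirchSwinnertonDyer.Theorems

/-! ### §1 Pointwise: the secant `54r − 135 ≤ 3^r` -/

/-- The secant of `r ↦ 3^r` through `(3, 27)` and `(4, 81)` lies below the graph on `ℕ`:
`54·r − 135 ≤ 3^r` (`r ≤ 2`: left side `< 0`; `r ≥ 3`: induction, `3·(54r − 135) ≥ 54(r+1) − 135`). [folklore] -/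
theorem fiftyfour_mul_sub_le_three_pow (r : ℕ) : 54 * (r : ℝ) - 135 ≤ (3 : ℝ) ^ r := by
  rcases lt_or_ge r 3 with hlt | hge
  · have hr : (r : ℝ) ≤ 2 := by exact_mod_cast Nat.lt_succ_iff.mp hlt
    have h1 : (0 : ℝ) < (3 : ℝ) ^ r := by positivity
    linarith
  · induction r, hge using Nat.le_induction with
    | base => norm_num
    | succ n hn ih =>
      have hn' : (3 : ℝ) ≤ n := by exact_mod_cast hn
      rw [pow_succ, Nat.cast_succ]
      nlinarith

/-- Member-wise: `54·rank E_a(ℚ) − 135 ≤ #Sel₃(E_a)` for every member `a` of `F₂` (secant + Kummer injection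
`3^rank ≤ #Sel₃`). [cite: SilvermanAEC2009, Thm X.4.2] -/
theorem fiftyfour_mul_rank_sub_le_natCard_selmerGroup (a : Params) (ha : a.IsMember) :
    54 * (a.curve.mordellWeilRank : ℝ) - 135 ≤ (Nat.card (a.curve.selmerGroup 3) : ℝ) :=
  (fiftyfour_mul_sub_le_three_pow _).trans (three_pow_mordellWeilRank_le_natCard_selmerGroup a ha)

/-! ### §2 Finite height balls: `54·avg rank − 135 ≤ avg #Sel₃` -/

/-- Averages are homogeneous: `avg (c·f) = c · avg f`. [folklore] -/
theorem averageOn_const_mul (Φ : CongruenceFamily₂) (c : ℝ) (f : Params → ℝ) (X : ℕ) :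
    Φ.averageOn (fun a ↦ c * f a) X = c * Φ.averageOn f X := by
  rw [averageOn_eq_sum_div, averageOn_eq_sum_div, ← Finset.mul_sum, mul_div_assoc]

/-- Averages respect subtraction: `avg (f − g) = avg f − avg g`. [folklore] -/
theorem averageOn_sub (Φ : CongruenceFamily₂) (f g : Params → ℝ) (X : ℕ) :
    Φ.averageOn (fun a ↦ f a - g a) X = Φ.averageOn f X - Φ.averageOn g X := by
  simp only [averageOn_eq_sum_div, Finset.sum_sub_distrib, sub_div]

/-- On an EMPTY height ball every average is the junk value `0`. [folklore] -/
theorem averageOn_of_card_eq_zero (Φ : CongruenceFamily₂) (f : Params → ℝ) {X : ℕ}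
    (h0 : (Φ.below X).card = 0) : Φ.averageOn f X = 0 := by
  rw [averageOn_eq_sum_div, Finset.card_eq_zero.mp h0, Finset.sum_empty, zero_div]

/-- **`54 · avg_{Φ(<X)} rank − 135 ≤ avg_{Φ(<X)} #Sel₃`** on every nonempty height ball of any subfamily `Φ ⊆ F₂`.
[cite: SilvermanAEC2009, Thm X.4.2] -/
theorem fiftyfour_mul_averageRank_sub_le_averageOn_selmerThree (Φ : CongruenceFamily₂) {X : ℕ}
    (hpos : 0 < (Φ.below X).card) :
    54 * Φ.averageOn (fun a ↦ (a.curve.mordellWeilRank : ℝ)) X - 135 ≤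
      Φ.averageOn (fun a ↦ (Nat.card (a.curve.selmerGroup 3) : ℝ)) X := by
  have h135 : (135 : ℝ) = Φ.averageOn (fun _ ↦ (135 : ℝ)) X := by
    rw [show (fun _ : Params ↦ (135 : ℝ)) = fun _ ↦ 135 * (1 : ℝ) by simp, averageOn_const_mul,
      averageOn_one_of_card_pos Φ hpos, mul_one]
  rw [h135, ← averageOn_const_mul, ← averageOn_sub]
  exact averageOn_mono Φ (fun a ha ↦ fiftyfour_mul_rank_sub_le_natCard_selmerGroup a ha.1) X

/-! ### §3 The cap: `limsup avg rank ≤ (c + 135)/54`, i.e. `≤ 19/6` under I1 -/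

/-- **Average-rank cap from a `3`-Selmer average bound.** On any `Φ ⊆ F₂`: if `Φ.AverageOnLE #Sel₃ c` with `c ≥ 0`,
then for every `ε > 0`, eventually `avg_{Φ(<X)} rank E_a(ℚ) ≤ (c + 135)/54 + ε`. [cite: SilvermanAEC2009, Thm X.4.2] -/
theorem averageRank_le_of_selmerThreeAverageLE (Φ : CongruenceFamily₂) {c : ℝ} (hc : 0 ≤ c)
    (h : Φ.AverageOnLE (fun a ↦ (Nat.card (a.curve.selmerGroup 3) : ℝ)) c) {ε : ℝ} (hε : 0 < ε) :
    ∀ᶠ X : ℕ in atTop, Φ.averageOn (fun a ↦ (a.curve.mordellWeilRank : ℝ)) X ≤ (c + 135) / 54 + ε := by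
  refine (h (54 * ε) (by positivity)).mono fun X hX ↦ ?_
  rcases Nat.eq_zero_or_pos (Φ.below X).card with h0 | hpos
  · rw [averageOn_of_card_eq_zero Φ _ h0]
    have : 0 ≤ (c + 135) / 54 := by positivity
    linarith
  · have hball := fiftyfour_mul_averageRank_sub_le_averageOn_selmerThree Φ hpos
    have h54 : 54 * Φ.averageOn (fun a ↦ (a.curve.mordellWeilRank : ℝ)) X ≤ (c + 135) + 54 * ε := by linarith
    have : Φ.averageOn (fun a ↦ (a.curve.mordellWeilRank : ℝ)) X ≤ ((c + 135) + 54 * ε) / 54 := by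
      rw [le_div_iff₀ (by norm_num : (0 : ℝ) < 54)]; linarith
    calc Φ.averageOn (fun a ↦ (a.curve.mordellWeilRank : ℝ)) X ≤ ((c + 135) + 54 * ε) / 54 := this
      _ = (c + 135) / 54 + ε := by ring

/-- The same cap in the `AverageOnLE` currency: `Φ.AverageOnLE #Sel₃ c` (`c ≥ 0`) ⇒ `Φ.AverageOnLE rank ((c + 135)/54)`.
[cite: SilvermanAEC2009, Thm X.4.2] -/
theorem averageOnLE_rank_of_selmerThreeAverageLE (Φ : CongruenceFamily₂) {c : ℝ} (hc : 0 ≤ c)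
    (h : Φ.AverageOnLE (fun a ↦ (Nat.card (a.curve.selmerGroup 3) : ℝ)) c) :
    Φ.AverageOnLE (fun a ↦ (a.curve.mordellWeilRank : ℝ)) ((c + 135) / 54) :=
  fun _ hε ↦ averageRank_le_of_selmerThreeAverageLE Φ hc h hε

/-- **I1 ⇒ the average-rank cap `19/6` on every large family.** The route decl `SelmerThreeAverageLargeF2` (BY NAME)
implies: for every large `Φ ⊆ F₂` and every `ε > 0`, eventually `avg_{Φ(<X)} rank E_a(ℚ) ≤ 19/6 + ε`
(`(36 + 135)/54 = 19/6 ≈ 3.1667`). Readings of record (window averages of F₂, sel3-p2 GEN 3/4): `3.08`, `3.117`,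
`3.147` on `[10¹², 10¹³)`, `[10¹³, 10¹⁴)`, `[10¹⁴, 10¹⁵)`. [cite: BhargavaHo2022, Thm. 1.3 (average rank in F₂)]
[cite: SilvermanAEC2009, Thm X.4.2] -/
theorem averageRank_le_of_selmerThreeAverageLargeF2 (h1 : SelmerThreeAverageLargeF2)
    (Φ : CongruenceFamily₂) (hΦ : Φ.IsLarge) {ε : ℝ} (hε : 0 < ε) :
    ∀ᶠ X : ℕ in atTop, Φ.averageOn (fun a ↦ (a.curve.mordellWeilRank : ℝ)) X ≤ 19 / 6 + ε := by
  have h := averageRank_le_of_selmerThreeAverageLE Φ (by norm_num) (h1 Φ hΦ) hε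
  norm_num at h ⊢
  exact h

/-- The same in the `AverageOnLE` currency: I1 ⇒ `Φ.AverageOnLE rank (19/6)` on every large `Φ`.
[cite: SilvermanAEC2009, Thm X.4.2] -/
theorem averageOnLE_rank_of_selmerThreeAverageLargeF2 (h1 : SelmerThreeAverageLargeF2)
    (Φ : CongruenceFamily₂) (hΦ : Φ.IsLarge) :
    Φ.AverageOnLE (fun a ↦ (a.curve.mordellWeilRank : ℝ)) (19 / 6) := by
  have h := averageOnLE_rank_of_selmerThreeAverageLE Φ (by norm_num) (h1 Φ hΦ)
  norm_num at h
  exact h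

/-! ### §4 The falsifier in its correct (limsup) shape, plain and CERTIFIED -/

/-- **Formal falsifier of I1 through the average rank.** ONE large `Φ ⊆ F₂` and one `ε > 0` such that
`avg_{Φ(<X)} rank E_a(ℚ) > 19/6 + ε` for infinitely many height bounds `X` refute `SelmerThreeAverageLargeF2`.
[cite: SilvermanAEC2009, Thm X.4.2] -/
theorem not_selmerThreeAverageLargeF2_of_frequently_averageRank (Φ : CongruenceFamily₂) (hΦ : Φ.IsLarge)
    {ε : ℝ} (hε : 0 < ε)
    (hfreq : ∃ᶠ X : ℕ in atTop, 19 / 6 + ε < Φ.averageOn (fun a ↦ (a.curve.mordellWeilRank : ℝ)) X) :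
    ¬ SelmerThreeAverageLargeF2 := fun h1 ↦ by
  obtain ⟨X, hlt, hle⟩ := (hfreq.and_eventually (averageRank_le_of_selmerThreeAverageLargeF2 h1 Φ hΦ hε)).exists
  exact absurd hle (not_le.mpr hlt)

/-- **CERTIFIED falsifier.** The datum per member is only a LOWER bound `ℓ a ≤ rank E_a(ℚ)` (e.g. `ℓ a` independent
rational points exhibited — no descent upper bound, no Ш): if on ONE large `Φ` the finite averages of `ℓ` exceed
`19/6 + ε` for infinitely many `X`, then `SelmerThreeAverageLargeF2` is false. [cite: SilvermanAEC2009, Thm X.4.2] -/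
theorem not_selmerThreeAverageLargeF2_of_frequently_average_lowerBound (Φ : CongruenceFamily₂) (hΦ : Φ.IsLarge)
    (ℓ : Params → ℕ) (hℓ : ∀ a, Φ.Mem a → ℓ a ≤ a.curve.mordellWeilRank) {ε : ℝ} (hε : 0 < ε)
    (hfreq : ∃ᶠ X : ℕ in atTop, 19 / 6 + ε < Φ.averageOn (fun a ↦ (ℓ a : ℝ)) X) :
    ¬ SelmerThreeAverageLargeF2 :=
  not_selmerThreeAverageLargeF2_of_frequently_averageRank Φ hΦ hε
    (hfreq.mono fun X hX ↦ hX.trans_le (averageOn_mono Φ (fun a ha ↦ by exact_mod_cast hℓ a ha) X))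

end Summit.BirchSwinnertonDyer.BirchSwinnertonDyer.Theorems

end
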